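import Summits.AtomisticToContinuum.BoseEinsteinCondensation.Theses.BECInfraredBound
import Literature.MathematicalPhysics.QuantumManyBody.BoseGasSubcellNoClumping
import Literature.MathematicalPhysics.QuantumManyBody.BoseGasSlabDepletionFree
import Literature.MathematicalPhysics.QuantumManyBody.BoseGasFreeDirichletBEC
import HarnessLib

/-!
# Line `Sketch` (= idea cards `noclumping-cover` / `noclumping-sum`) — crux `BecShellMass`
# (stmt-AtomisticToContinuum-0734), route `BECInfraredBound`; lead prover's skeleton

The crux BY NAME (`Summit.AtomisticToContinuum.BoseEinsteinCondensation.Theses.BECInfraredBound.BecShellMass`):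
NO BOUNDARY ACCUMULATION — for every repulsive finite-range `v` there is `C` such that for every
`ε ∈ (0, 1/4)`, some `ρ₀(ε) > 0`, all `0 < ρ < ρ₀`, all large `N`, some `δ > 0` and every Dirichlet
`δ`-near-minimiser `Ψ` in the box of side `L = (N/ρ)^{1/3}`, the expected number of particles in the
shell `Λ_L ∖ (εL, L−εL)³` is `≤ C ε N`.

## The line: over-cover the shell by the outer dyadic cell layers of the in-tree no-clumping theorem

Split on the scattering length `a = scatteringLength v`.

* INTERACTING (`0 < a`). The tree theorem
  `BoseGas.sum_massAverage_card_tsub_le_of_scatteringLength_pos` (LSSY's cell method (2.52)–(2.58)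
  with the crowding penalty, `BoseGasSubcellNoClumping.lean`): for `0 < η ≤ 1`, `M > 0`, all
  `ρ < ρ₀(η, M, v)`, eventually in `N`, every `1`-near-minimiser `Ψ` and every dyadic level `k` with
  `M/√ρ ≤ L/2^k < 2M/√ρ` satisfy `Σ_c (N_c − (1+η)N/8^k)₊ ≤ ηN`, where
  `N_c = Σ_σ mass_σ(Ψ) · #{j : σ j = c}` is the expected number of particles in the open cell `c` of
  the aligned grid of `8^k` cells of side `s = L/2^k`.  Take `η := ε`, `M := 1`, `δ := 1`,
  `2^k ≤ L√ρ < 2^{k+1}` (exists once `L√ρ ≥ 1`), `m := ⌊ε2^k⌋ + 1` outer layers (so `εL ≤ m s`):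
  - `stub_shellCover` (deterministic, any `C¹` Dirichlet state): the one-body shell mass of width
    `w ≤ m s` is at most `Σ_{c outer} N_c`, "outer" = some lattice coordinate `< m` or `≥ K − m`
    (on `cellSet σ` a particle of a non-outer cell lies in `(ms, (K−m)s)³ ⊆ (w, L−w)³`; the cells
    partition `Λ_L^N` a.e.; exchange the two finite sums);
  - `stub_outerCard`: `#outer ≤ 6 m K²` (union bound over the three axes and the two sides);
  - glue (here, sorry-free): `Σ_{c∈T} N_c ≤ #T·cap + Σ_c (N_c − cap)₊`, and the arithmetic
    `6(ε2^k + 1)4^k · (1+ε)N/8^k + εN ≤ 10 ε N` once `2^k ≥ 6/ε` (eventually: `2^{k+1} > L√ρ → ∞`).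
* FREE (`a = 0`): `LSSY2005_zeroScatteringLength_holds` gives `v(|x|) = 0` a.e., so
  `E₀(v) = E₀(0) ≤ E₁ N/L²` (`groundStateEnergy_eq_zero_potential`, `groundStateEnergy_zero_le`,
  `E₁` = energy of the unit bump) and `energy v Ψ ≥ ∫|∇Ψ|²`; `stub_boundaryLayerPoincare`
  (`f(0) = 0 ⇒ ∫₀ʷ|f|² ≤ w²∫₀ʷ|f′|²` on the lines normal to the six faces, tree
  `poincare_Ioo_of_zero` + `lintegral_le_of_forall_line`) with `w = εL`, `δ = N/L²` bounds the shell
  mass by `(εL)²(E₁ + 1)N/L² ≤ (E₁ + 1) ε N`.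

Composition: `becShellMass_of_stubs : stub_boundaryLayerPoincare → stub_shellCover → stub_outerCard →
BecShellMass` (kernel-checked `by_cases` on `scatteringLength v = 0`), and `BecShellMass_of` — the
crux BY NAME from the three registered stubs.

Disproof used: none exists for this crux (payload `disproof_path` absent; `ledger crux ls`: no
`Disproof.lean`, 2026-08-17T18:20Z).  Refuter evidence honoured: `v ≡ 0` admissible (g12-5) — the
free branch; hard cores admissible — the no-clumping theorem allows them; `∃C` before `∀ε` — `C` is
`max`-free: `E₁ + 1` (free) resp. `10` (interacting), chosen after `v` only.
-/

noncomputable section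

namespace Summit.AtomisticToContinuum.BoseEinsteinCondensation.Theorems.BecShellMass

open Literature.MathematicalPhysics.QuantumManyBody.BoseGas
open _root_.MeasureTheory _root_.Filter
open scoped ENNReal Topology
open Summit.AtomisticToContinuum.BoseEinsteinCondensation.Theses

/-! ### Stub statements (namespace `Stmt`) -/

namespace Stmt

/-- **Stub `stub_boundaryLayerPoincare`** (boundary-layer Poincaré inequality for Dirichlet trial
states): the expected number of particles within sup-distance `w` of the boundary of the box is at most
`w²` times the kinetic energy (`f(0) = 0 ⇒ ∫₀ʷ |f|² ≤ w² ∫₀ʷ |f'|²` on every line normal to a face,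
summed over the six faces; `2w ≤ L` keeps the two slabs of a line disjoint). -/
def stub_boundaryLayerPoincare : Prop :=
  ∀ (N : ℕ) (L w : ℝ), 0 < w → 2 * w ≤ L →
    ∀ Ψ : Literature.MathematicalPhysics.QuantumManyBody.BoseGas.TrialState N L,
      (∑ i : Fin N, ∫⁻ X, {x : EuclideanSpace ℝ (Fin 3) | ∀ j, x j ∈ Set.Ioo w (L - w)}ᶜ.indicator
          (fun _ => (1 : ℝ≥0∞)) (X i) * (‖Ψ.ψ X‖₊ : ℝ≥0∞) ^ 2) ≤
        ENNReal.ofReal (w ^ 2) *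
          ∫⁻ X, Literature.MathematicalPhysics.QuantumManyBody.BoseGas.kineticDensity Ψ.ψ X

/-- **Stub `stub_shellCover`** (deterministic cover of the shell by the outer cells): for the aligned
grid of `K³` open cells of side `s` in `Λ_L` (`Ks = L`) and a shell width `w ≤ m s`, the one-body shell
mass of any Dirichlet trial state is at most the sum over the OUTER cells (some lattice coordinate
`< m` or `≥ K - m`) of the expected cell numbers `N_c = Σ_σ mass_σ · #{j : σ j = c}`. -/
def stub_shellCover : Prop :=
  ∀ (N K m : ℕ) (s L w : ℝ), 0 < K → 0 < s → (K : ℝ) * s = L → w ≤ (m : ℝ) * s →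
    ∀ Ψ : Literature.MathematicalPhysics.QuantumManyBody.BoseGas.TrialState N L,
      (∑ i : Fin N, ∫⁻ X, {x : EuclideanSpace ℝ (Fin 3) | ∀ j, x j ∈ Set.Ioo w (L - w)}ᶜ.indicator
          (fun _ => (1 : ℝ≥0∞)) (X i) * (‖Ψ.ψ X‖₊ : ℝ≥0∞) ^ 2) ≤
        ∑ c ∈ Finset.univ.filter (fun c : Fin (K ^ 3) => ∃ a : Fin 3,
            (Literature.MathematicalPhysics.QuantumManyBody.BoseGas.cellCoord K c a : ℕ) < m ∨
              K ≤ (Literature.MathematicalPhysics.QuantumManyBody.BoseGas.cellCoord K c a : ℕ) + m),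
          ∑ σ : Fin N → Fin (K ^ 3),
            (∫⁻ X in Literature.MathematicalPhysics.QuantumManyBody.BoseGas.cellSet K s σ,
                (‖Ψ.ψ X‖₊ : ℝ≥0∞) ^ 2) *
              ((Finset.univ.filter fun j => σ j = c).card : ℝ≥0∞)

/-- **Stub `stub_outerCard`** (counting the outer cells): at most `6 m K²` cells of the `K³` grid have
some lattice coordinate `< m` or `≥ K - m` (union bound over three axes and two sides). -/
def stub_outerCard : Prop :=
  ∀ K m : ℕ, ((Finset.univ.filter (fun c : Fin (K ^ 3) => ∃ a : Fin 3,
      (Literature.MathematicalPhysics.QuantumManyBody.BoseGas.cellCoord K c a : ℕ) < m ∨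
        K ≤ (Literature.MathematicalPhysics.QuantumManyBody.BoseGas.cellCoord K c a : ℕ) + m)).card : ℝ)
    ≤ 6 * m * (K : ℝ) ^ 2

end Stmt

/-! ### Registered stubs -/

/-- stub (M: `poincare_Ioo_of_zero` on the lines normal to the faces via `lintegral_le_of_forall_line`
and `line_data`; type = `Stmt.stub_boundaryLayerPoincare`). -/
theorem stub_boundaryLayerPoincare : ∀ (N : ℕ) (L w : ℝ), 0 < w → 2 * w ≤ L → ∀ Ψ : Literature.MathematicalPhysics.QuantumManyBody.BoseGas.TrialState N L, (∑ i : Fin N, ∫⁻ X, {x : EuclideanSpace ℝ (Fin 3) | ∀ j, x j ∈ Set.Ioo w (L - w)}ᶜ.indicator (fun _ => (1 : ℝ≥0∞)) (X i) * (‖Ψ.ψ X‖₊ : ℝ≥0∞) ^ 2) ≤ ENNReal.ofReal (w ^ 2) * ∫⁻ X, Literature.MathematicalPhysics.QuantumManyBody.BoseGas.kineticDensity Ψ.ψ X := by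
  sorry

/-- stub (M: a.e. partition `boxN_ae_eq_iUnion_cellSet` + pointwise `1_shell(X i) ≤ 1[σ i outer]`
on `cellSet σ` + `Finset.sum_comm`; type = `Stmt.stub_shellCover`). -/
theorem stub_shellCover : ∀ (N K m : ℕ) (s L w : ℝ), 0 < K → 0 < s → (K : ℝ) * s = L → w ≤ (m : ℝ) * s → ∀ Ψ : Literature.MathematicalPhysics.QuantumManyBody.BoseGas.TrialState N L, (∑ i : Fin N, ∫⁻ X, {x : EuclideanSpace ℝ (Fin 3) | ∀ j, x j ∈ Set.Ioo w (L - w)}ᶜ.indicator (fun _ => (1 : ℝ≥0∞)) (X i) * (‖Ψ.ψ X‖₊ : ℝ≥0∞) ^ 2) ≤ ∑ c ∈ Finset.univ.filter (fun c : Fin (K ^ 3) => ∃ a : Fin 3, (Literature.MathematicalPhysics.QuantumManyBody.BoseGas.cellCoord K c a : ℕ) < m ∨ K ≤ (Literature.MathematicalPhysics.QuantumManyBody.BoseGas.cellCoord K c a : ℕ) + m), ∑ σ : Fin N → Fin (K ^ 3), (∫⁻ X in Literature.MathematicalPhysics.QuantumManyBody.BoseGas.cellSet K s σ, (‖Ψ.ψ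 X‖₊ : ℝ≥0∞) ^ 2) * ((Finset.univ.filter fun j => σ j = c).card : ℝ≥0∞) := by
  sorry

/-- stub (S: `Fintype.card_piFinset` after `cellCoord = finFunctionFinEquiv.symm`, union bound;
type = `Stmt.stub_outerCard`). -/
theorem stub_outerCard : ∀ K m : ℕ, ((Finset.univ.filter (fun c : Fin (K ^ 3) => ∃ a : Fin 3, (Literature.MathematicalPhysics.QuantumManyBody.BoseGas.cellCoord K c a : ℕ) < m ∨ K ≤ (Literature.MathematicalPhysics.QuantumManyBody.BoseGas.cellCoord K c a : ℕ) + m)).card : ℝ) ≤ 6 * m * (K : ℝ) ^ 2 := by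
  sorry

example : Stmt.stub_boundaryLayerPoincare := stub_boundaryLayerPoincare
example : Stmt.stub_shellCover := stub_shellCover
example : Stmt.stub_outerCard := stub_outerCard

/-! ### Sorry-free glue -/

/-- **Summing a sub-family against a cap**: if the total truncated excess `Σ_c (f c - cap)₊` is at most
`B`, then any sub-family `T` carries at most `#T · cap + B`. [folklore] -/
theorem sum_le_card_mul_add {ι : Type*} [Fintype ι] (T : Finset ι) (f : ι → ℝ≥0∞) (cap B : ℝ≥0∞)
    (h : ∑ c, (f c - cap) ≤ B) : ∑ c ∈ T, f c ≤ (T.card : ℝ≥0∞) * cap + B := by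
  calc ∑ c ∈ T, f c ≤ ∑ c ∈ T, (cap + (f c - cap)) := Finset.sum_le_sum fun c _ => le_add_tsub
    _ = (T.card : ℝ≥0∞) * cap + ∑ c ∈ T, (f c - cap) := by
        rw [Finset.sum_add_distrib, Finset.sum_const, nsmul_eq_mul]
    _ ≤ (T.card : ℝ≥0∞) * cap + ∑ c, (f c - cap) :=
        add_le_add le_rfl (Finset.sum_le_sum_of_subset (Finset.subset_univ T))
    _ ≤ (T.card : ℝ≥0∞) * cap + B := add_le_add le_rfl h

/-- **FREE BRANCH.** For `v(|x|) = 0` a.e. the energy is the free Dirichlet energy, of size `O(N/L²)`;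
the boundary-layer Poincaré inequality (`stub_boundaryLayerPoincare`, width `w = εL`, slack `δ = N/L²`)
bounds the shell mass by `(εL)²·(E₁ + 1)N/L² = (E₁ + 1)ε²N ≤ (E₁ + 1)εN`, `E₁` the energy of the unit
bump (tree). [folklore] -/
theorem shellMass_free (hP : Stmt.stub_boundaryLayerPoincare) {v : ℝ → ℝ≥0∞}
    (hv : IsRepulsiveFiniteRange v) (hae : ∀ᵐ x : Space, v ‖x‖ = 0) :
    ∃ C : ℝ, 0 < C ∧ ∀ ε : ℝ, 0 < ε → ε < 1 / 4 → ∃ ρ₀ : ℝ, 0 < ρ₀ ∧ ∀ ρ : ℝ, 0 < ρ → ρ < ρ₀ →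
      ∀ᶠ N : ℕ in atTop, ∃ δ : ℝ≥0∞, 0 < δ ∧ ∀ Ψ : TrialState N (sideLength ρ N),
        energy v Ψ ≤ groundStateEnergy v N (sideLength ρ N) + δ →
        (∑ i : Fin N, ∫⁻ X, {x : Space | ∀ j, x j ∈ Set.Ioo (ε * sideLength ρ N)
            (sideLength ρ N - ε * sideLength ρ N)}ᶜ.indicator (fun _ => (1 : ℝ≥0∞)) (X i) *
            (‖Ψ.ψ X‖₊ : ℝ≥0∞) ^ 2) ≤ ENNReal.ofReal (C * ε * N) := by
  set E₁ : ℝ := (energy 0 unitBump).toReal with hE₁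
  have hE₁0 : 0 ≤ E₁ := ENNReal.toReal_nonneg
  refine ⟨E₁ + 1, by positivity, fun ε hε hε4 => ⟨1, one_pos, fun ρ hρ _ => ?_⟩⟩
  filter_upwards [eventually_gt_atTop 0] with N hN
  have hL : 0 < sideLength ρ N := sideLength_pos_of_pos hρ hN
  have hNpos : (0 : ℝ) < N := Nat.cast_pos.2 hN
  set L := sideLength ρ N with hLdef
  have hL2 : (0 : ℝ) < L ^ 2 := by positivity
  refine ⟨ENNReal.ofReal ((N : ℝ) / L ^ 2), ENNReal.ofReal_pos.2 (by positivity), fun Ψ hΨ => ?_⟩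
  have hw : 0 < ε * L := by positivity
  have h2w : 2 * (ε * L) ≤ L := by nlinarith
  have h1 := hP N L (ε * L) hw h2w Ψ
  -- the kinetic energy is the energy, the energy at most `E₀(0) + δ ≤ (E₁ + 1) N / L²`
  have hkin : ∫⁻ X, kineticDensity Ψ.ψ X ≤ energy v Ψ :=
    (energy_eq_lintegral_kineticDensity hv.1 hae Ψ).ge
  have hE0 : groundStateEnergy v N L ≤ ENNReal.ofReal (E₁ * N / L ^ 2) := by
    rw [groundStateEnergy_eq_zero_potential hv.1 hae N L]
    refine (groundStateEnergy_zero_le hL N).trans (le_of_eq ?_)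
    rw [energy_unitBump_eq_ofReal, ← hE₁, ← ENNReal.ofReal_natCast,
      ← ENNReal.ofReal_mul N.cast_nonneg, ← ENNReal.ofReal_mul (inv_nonneg.2 hL2.le)]
    congr 1
    field_simp
  have hkinE : ENNReal.ofReal ((ε * L) ^ 2) * ∫⁻ X, kineticDensity Ψ.ψ X ≤
      ENNReal.ofReal ((ε * L) ^ 2) *
        (ENNReal.ofReal (E₁ * N / L ^ 2) + ENNReal.ofReal ((N : ℝ) / L ^ 2)) := by
    gcongr
    exact hkin.trans (hΨ.trans (add_le_add hE0 le_rfl))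
  calc _ ≤ _ := h1
    _ ≤ _ := hkinE
    _ = ENNReal.ofReal ((ε * L) ^ 2 * (E₁ * N / L ^ 2 + N / L ^ 2)) := by
        rw [← ENNReal.ofReal_add (by positivity) (by positivity),
          ← ENNReal.ofReal_mul (by positivity)]
    _ ≤ ENNReal.ofReal ((E₁ + 1) * ε * N) := by
        refine ENNReal.ofReal_le_ofReal ?_
        have hid : (ε * L) ^ 2 * (E₁ * N / L ^ 2 + N / L ^ 2) = ε ^ 2 * ((E₁ + 1) * N) := by
          field_simp
        rw [hid]
        have hX : 0 ≤ (E₁ + 1) * N := by positivity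
        have hε1 : ε ^ 2 ≤ ε := by nlinarith
        nlinarith [mul_le_mul_of_nonneg_right hε1 hX]

/-- **The arithmetic of the interacting branch**: with `K = 2^k`, `m ≤ εK + 1`, `6 ≤ εK`,
`0 < ε < 1/4`, `#outer ≤ 6mK²`: `#outer · (1+ε)N/K³ + εN ≤ 10 ε N`. [folklore] -/
theorem interacting_arith {ε K m card N : ℝ} (hε : 0 < ε) (hε4 : ε < 1 / 4) (hK : 0 < K)
    (hm : m ≤ ε * K + 1) (h6 : 6 ≤ ε * K) (hN : 0 ≤ N) (hcard : card ≤ 6 * m * K ^ 2) :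
    card * ((1 + ε) * N / K ^ 3) + ε * N ≤ 10 * ε * N := by
  have hK2 : 0 < K ^ 2 := by positivity
  have hK3 : 0 < K ^ 3 := by positivity
  -- `card / K³ ≤ 6 m / K ≤ 6 (ε + 1/K) ≤ 7 ε`
  have h1 : card * ((1 + ε) * N / K ^ 3) = (card / K ^ 3) * ((1 + ε) * N) := by
    field_simp
  have h2 : card / K ^ 3 ≤ 7 * ε := by
    rw [div_le_iff₀ hK3]
    have h3 : 6 * m * K ^ 2 ≤ 6 * (ε * K + 1) * K ^ 2 := by nlinarith
    have h4 : 6 * (ε * K + 1) * K ^ 2 ≤ 7 * ε * K ^ 3 := by nlinarith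
    nlinarith
  rw [h1]
  have h5 : (card / K ^ 3) * ((1 + ε) * N) ≤ 7 * ε * ((1 + ε) * N) :=
    mul_le_mul_of_nonneg_right h2 (by positivity)
  nlinarith [mul_nonneg hε.le hN]

/-- **INTERACTING BRANCH** (`a(v) > 0`): the no-clumping theorem at `η = ε`, `M = 1`, the dyadic level
`2^k ≤ L√ρ < 2^{k+1}`, the `m = ⌊ε2^k⌋ + 1` outer layers, the cover and the count give the shell bound
with `C = 10`, `δ = 1`. [folklore] -/
theorem shellMass_interacting (hCov : Stmt.stub_shellCover) (hCard : Stmt.stub_outerCard)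
    {v : ℝ → ℝ≥0∞} (hv : IsRepulsiveFiniteRange v) (hapos : 0 < scatteringLength v) :
    ∀ ε : ℝ, 0 < ε → ε < 1 / 4 → ∃ ρ₀ : ℝ, 0 < ρ₀ ∧ ∀ ρ : ℝ, 0 < ρ → ρ < ρ₀ →
      ∀ᶠ N : ℕ in atTop, ∃ δ : ℝ≥0∞, 0 < δ ∧ ∀ Ψ : TrialState N (sideLength ρ N),
        energy v Ψ ≤ groundStateEnergy v N (sideLength ρ N) + δ →
        (∑ i : Fin N, ∫⁻ X, {x : Space | ∀ j, x j ∈ Set.Ioo (ε * sideLength ρ N)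
            (sideLength ρ N - ε * sideLength ρ N)}ᶜ.indicator (fun _ => (1 : ℝ≥0∞)) (X i) *
            (‖Ψ.ψ X‖₊ : ℝ≥0∞) ^ 2) ≤ ENNReal.ofReal (10 * ε * N) := by
  intro ε hε hε4
  obtain ⟨ρ₀, hρ₀, H⟩ :=
    sum_massAverage_card_tsub_le_of_scatteringLength_pos hv hapos hε (by linarith) one_pos
  refine ⟨ρ₀, hρ₀, fun ρ hρ hρlt => ?_⟩
  have hsr : 0 < Real.sqrt ρ := Real.sqrt_pos.2 hρ
  have hLbig : ∀ᶠ N : ℕ in atTop, 12 / (ε * Real.sqrt ρ) ≤ sideLength ρ N :=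
    (tendsto_sideLength_atTop hρ).eventually_ge_atTop _
  filter_upwards [H ρ hρ hρlt, hLbig, eventually_gt_atTop 0] with N hN hLN hNpos
  have hL : 0 < sideLength ρ N := sideLength_pos_of_pos hρ hNpos
  set L := sideLength ρ N with hLdef
  refine ⟨1, one_pos, fun Ψ hΨ => ?_⟩
  have hNr : (0 : ℝ) ≤ N := Nat.cast_nonneg N
  -- `L √ρ ≥ 12/ε ≥ 1`
  have hLs : 12 / ε ≤ L * Real.sqrt ρ := by
    have := (div_le_iff₀ (mul_pos hε hsr)).1 hLN
    rw [div_le_iff₀ hε]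
    linarith
  have h12ε : (48 : ℝ) ≤ 12 / ε := by
    rw [le_div_iff₀ hε]; linarith
  have hx1 : 1 ≤ L * Real.sqrt ρ := by linarith
  -- the dyadic level
  obtain ⟨k, hk1, hk2⟩ := exists_nat_pow_near hx1 one_lt_two
  set Kr : ℝ := (2 : ℝ) ^ k with hKr
  have hKr0 : 0 < Kr := by positivity
  have hgrid1 : 1 / Real.sqrt ρ ≤ L / 2 ^ k := by
    rw [div_le_div_iff₀ hsr hKr0]; linarith
  have hgrid2 : L / 2 ^ k < 2 * (1 / Real.sqrt ρ) := by
    rw [mul_one_div, div_lt_div_iff₀ hKr0 hsr]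
    calc L * Real.sqrt ρ < 2 ^ (k + 1) := hk2
      _ = 2 * 2 ^ k := by ring
  have hNC := hN Ψ hΨ k hgrid1 hgrid2
  -- the grid data
  set K : ℕ := 2 ^ k with hKdef
  set s : ℝ := L / 2 ^ k with hsdef
  have hK : 0 < K := pow_pos two_pos k
  have hs : 0 < s := by positivity
  have hKcast : (K : ℝ) = Kr := by rw [hKdef, hKr]; push_cast; rfl
  have hKs : (K : ℝ) * s = L := by rw [hKcast, hsdef, hKr]; field_simp
  set m : ℕ := ⌊ε * Kr⌋₊ + 1 with hmdef
  have hεK0 : 0 ≤ ε * Kr := by positivity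
  have hm_lo : ε * Kr < m := by rw [hmdef]; push_cast; exact Nat.lt_floor_add_one _
  have hm_hi : (m : ℝ) ≤ ε * Kr + 1 := by
    rw [hmdef]; push_cast; linarith [Nat.floor_le hεK0]
  have hw : ε * L ≤ (m : ℝ) * s := by
    have : ε * L = ε * Kr * s := by rw [hsdef, hKr]; field_simp
    rw [this]
    exact mul_le_mul_of_nonneg_right hm_lo.le hs.le
  -- `2^k ≥ 6/ε`
  have h6 : 6 ≤ ε * Kr := by
    have h2K : L * Real.sqrt ρ < 2 * Kr := by
      calc L * Real.sqrt ρ < 2 ^ (k + 1) := hk2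
        _ = 2 * Kr := by rw [hKr]; ring
    have : 12 ≤ ε * (L * Real.sqrt ρ) := by rwa [div_le_iff₀' hε] at hLs
    nlinarith
  -- cover, count, cap
  have hcov := hCov N K m s L (ε * L) hK hs hKs hw Ψ
  have hcardR := hCard K m
  set outer := Finset.univ.filter (fun c : Fin (K ^ 3) => ∃ a : Fin 3,
      (cellCoord K c a : ℕ) < m ∨ K ≤ (cellCoord K c a : ℕ) + m) with houter
  set Nc : Fin (K ^ 3) → ℝ≥0∞ := fun c => ∑ σ : Fin N → Fin (K ^ 3),
      (∫⁻ X in cellSet K s σ, (‖Ψ.ψ X‖₊ : ℝ≥0∞) ^ 2) *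
        ((Finset.univ.filter fun j => σ j = c).card : ℝ≥0∞) with hNc
  set cap : ℝ := (1 + ε) * N / 8 ^ k with hcap
  have hcap0 : 0 ≤ cap := by positivity
  have hNC' : ∑ c, (Nc c - ENNReal.ofReal cap) ≤ ENNReal.ofReal (ε * N) := hNC
  have hsum := sum_le_card_mul_add outer Nc (ENNReal.ofReal cap) (ENNReal.ofReal (ε * N)) hNC'
  have h8 : (8 : ℝ) ^ k = Kr ^ 3 := by
    rw [hKr, ← pow_mul, show (8 : ℝ) = 2 ^ 3 by norm_num, ← pow_mul, mul_comm]
  have harith : (outer.card : ℝ) * cap + ε * N ≤ 10 * ε * N := by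
    rw [hcap, h8]
    refine interacting_arith hε hε4 hKr0 hm_hi h6 hNr ?_
    rw [← hKcast]; exact hcardR
  calc _ ≤ ∑ c ∈ outer, Nc c := hcov
    _ ≤ (outer.card : ℝ≥0∞) * ENNReal.ofReal cap + ENNReal.ofReal (ε * N) := hsum
    _ = ENNReal.ofReal ((outer.card : ℝ) * cap + ε * N) := by
        rw [ENNReal.ofReal_add (by positivity) (by positivity), ENNReal.ofReal_mul (Nat.cast_nonneg _),
          ENNReal.ofReal_natCast]
    _ ≤ ENNReal.ofReal (10 * ε * N) := ENNReal.ofReal_le_ofReal harith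

/-- **The crux from the stubs** (kernel-checked composition, no `sorry` of its own): split on whether
the scattering length vanishes. [folklore] -/
theorem becShellMass_of_stubs (hP : Stmt.stub_boundaryLayerPoincare) (hCov : Stmt.stub_shellCover)
    (hCard : Stmt.stub_outerCard) : BECInfraredBound.BecShellMass := by
  intro v hv
  by_cases ha0 : scatteringLength v = 0
  · obtain ⟨R₀, hR₀⟩ := hv.2
    exact shellMass_free hP hv (LSSY2005_zeroScatteringLength_holds v R₀ hv.1 hR₀ ha0)
  · exact ⟨10, by norm_num, shellMass_interacting hCov hCard hv (pos_iff_ne_zero.2 ha0)⟩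

/-- The crux BY NAME from the three registered stubs. [folklore] -/
theorem BecShellMass_of : BECInfraredBound.BecShellMass :=
  becShellMass_of_stubs stub_boundaryLayerPoincare stub_shellCover stub_outerCard

end Summit.AtomisticToContinuum.BoseEinsteinCondensation.Theorems.BecShellMass

end
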